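import Summits.QuantumFields.BalabanUV.Beta.WardLocusQuarticTableSlot
import Summits.QuantumFields.BalabanUV.Beta.WardLocusRecursiveStepSlot
import Summits.QuantumFields.BalabanUV.Beta.WardLocusRecursiveAll

/-!
# `BalabanUV.Beta.WardLocusRecursiveAllSlot` — binder row D1, SECOND-ORDER hW (W-side), SLOT-GENERIC part C: THE LEVEL RECURSION OF THE WARD KERNEL LAW
# OF THE SLOTTED W-TABLES `WrecOf G (SpureRecOf V H G) M …` — level `0` from the three level-`0` LETTERS (Wilson, border, mixed), level `j+1` from the
# level-`j` kernel law + the two level-(j+1) LETTERS (border, mixed) + one units lock — part A (`WardLocusQuarticTableSlot`) ∘ part B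
# (`WardLocusRecursiveStepSlot`); the twin of `WardLocusRecursiveAll` with the wall objects replaced by SLOTS under DISPLAYED resolvent sockets
# (β sub-cell, BINDER-OWNERS row D1 OWNER `b2b-balaban-beta-an2`, gen 29; INTENT «SYM-hW-SECOND-ORDER» journal [AN2-G29-ONLINE])

HONEST FRAMING (cell charter, verbatim): «discharging BetaPertH makes Bałaban's UV stability UNCONDITIONAL — a real constructive-QFT result; it is
NOT the continuum limit and NOT the Clay problem.»  HONEST DEPENDENCY: continuum YM on T⁴ ⇐ BetaPertH ∧ nine spine estimates (0/9 proved);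
BetaPertH ⇐ (D1) ∧ (D4) ∧ CAP+tail; G-an2-4 gates asym, D1 and NE2/3/4.
NOT IN PRINT; OUR BOOKKEEPING.  [folklore] composition of parts A and B; the resolvent sockets of EVERY level (`Spr (𝕄 j)`, `Spr E`, `RelInv (G j) (𝕄 j) E`,
ℋ-column Ward law `hH` with constants `cH j`, multiplier-column Ward law `hMw`, off-lattice vanishing `hoff`, `[E, X y] = 0`, the first-order law `hD`, the
order-one consistency (c1) `hc1`), the LETTERS (border law of the `vh₂S` sector both slots, mixed law of `M2Of mixFF j`, level-`0` Wilson law — with bounded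
remainders), the uniform bound of the transported residual and the units lock are DISPLAYED HYPOTHESES; no statement of Bałaban's papers, no `[cite:]`, no
`def`, no `def … : Prop`; instantiates NO binder of the β-function wall.  NOT hW, NOT D1, NOT `BetaPertH`, NOT continuum, NOT Clay.

* §1 **`divW_WrecOf_zero_of_letters`** — the level-`0` KERNEL law `hWd 0` of `WrecOf … 0` (conjV form, explicit residual) from the Wilson letters (both slots,
  remainders `RW`, `RW″`), the border letters (both slots, `RB`, `RB″`) and the mixed letter (`RM`), all bounded.
* §2 **`divW_WrecOf_succ_of_kernelLaw`** — THE INDUCTION STEP `hWd j ⟹ hWd (j+1)`: from the level-`j` kernel law with a localised residual `𝒩` whose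
  `G j`-sandwich block sums are uniformly bounded (`h𝒩b`, `h𝒩b''`), the level-(j+1) border letters (both slots) and mixed letter (bounded remainders), and the
  lock `cH (j+1)·(cE₂·wV4 (j+1))·ξ = (cE·wE (j+1))·ξ` ⇒ the level-(j+1) kernel law with its residual DISPLAYED.
Instances intended: the frozen comb (`WardLocusRecursiveAll`, every socket a theorem) and the (0.4) literal «JsB12Sym» (`G := Gsym`, `𝕄 j := bhKStepSh 3 Lc Dsh j`,
`E := symEc Lc`, `V := tabs.V`, `H := tabs.H`, `M := tabs.M`, `vh₂S := tabs.vh₂S`, `mixFF := tabs.mixFF`, `ξ = ½`, `cH j = (stepScale j·Lc⁴)⁻¹`).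
Provenance: β sub-cell, unit beta-an2 gen 29, 2026-08-21 (v1); over parts A∕B and leaf-06's `WardLocusRecursiveAll.abs_smul_add_le`∕`abs_add_le'` BY NAME;
no existing file touched.
-/

noncomputable section

open Finset
open scoped BigOperators
open Literature.MathematicalPhysics.QuantumFieldTheory
open Literature.MathematicalPhysics.QuantumFieldTheory.Balaban1983to89
open Literature.MathematicalPhysics.QuantumFieldTheory.Balaban1983to89.Beta
open B6BondElimination (unitVec)
open ExpKernelCalculus (MKer Decays BiLoc VertexFamily VertexFamily₂ comp)
open KernelWard (divV divW)
open AffineAveraging (Site box toSite)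
open OneStepResolventKernel (Fib wsum LocStencil)
open OneStepKernelFamily (colH vertexOfK)
open InterLevelTransport (cwsum)
open BalabanStepJetsSucc (mmRead wE wVH)
open SecondOrderResponse (colM vertexOfM dM K2OfK LocStencilFM)
open BalabanCompositeJets (LocStencil₂)
open BalabanStepW2 (M2Of wV4 wB2)
open StepJetData (wilsonA locStencil_add)
open WilsonBiStencil (wilsonW₂)
open Summit.QuantumFields.BalabanUV.Beta.TameKernelCalculus
open Summit.QuantumFields.BalabanUV.Beta.ChartConjugation (conjV)
open Summit.QuantumFields.BalabanUV.Beta.ChartConjugationRelative (RelInv)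
open Summit.QuantumFields.BalabanUV.Beta.BorderedHessian (diagK)
open Summit.QuantumFields.BalabanUV.Beta.AveragingWardRootedStencils (legInd)
open Summit.QuantumFields.BalabanUV.Beta.SpineRooted (e4OfKW SpureRecOf T2RecOf WrecOf)
open Summit.QuantumFields.BalabanUV.Beta.WardLocusRecursive (SrecOf)
open Summit.QuantumFields.BalabanUV.Beta.KernelWardRelative (gaugeWt)
open Summit.QuantumFields.BalabanUV.Beta.KernelWardLevels (loc_diagK_smul_sum_legInd)
open Summit.QuantumFields.BalabanUV.Beta.KernelWardResponse (decays_of_biLoc)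
open Summit.QuantumFields.BalabanUV.Beta.WardLocusQuarticTableSlot (tableLaw_T2RecOf_succ tableLaw_T2RecOf_succ'' tableLaw_T2RecOf_zero tableLaw_T2RecOf_zero'')
open Summit.QuantumFields.BalabanUV.Beta.WardLocusRecursiveStepSlot (divW_WrecOf_of_tableLaws loc_residual_WrecOf)
open Summit.QuantumFields.BalabanUV.Beta.WardLocusRecursiveAll (abs_smul_add_le abs_add_le')

namespace Summit.QuantumFields.BalabanUV.Beta.WardLocusRecursiveAllSlot

section Slot

variable {d Lc : ℕ} [NeZero Lc]
variable {V H : Fin (d + 1) → (Fin (d + 1) → ℤ) → MKer (d + 1) (Fib d)} {G : ℕ → MKer (d + 1) (Fib d)}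
  {M : ℕ → Fin (d + 1) → (Fin (d + 1) → ℤ) → MKer (d + 1) (Fib d)}

omit [NeZero Lc] in
/-- [folklore] The pinned block generator is a spread kernel (from its localisation, `KernelWardResponse.decays_of_biLoc`). -/
theorem spr_blockGen (r : Fin (d + 1) → ℕ) (ξ : ℝ) (y : Fin (d + 1) → ℤ) :
    Spr (diagK (ξ • ∑ v ∈ box (d + 1) Lc, legInd (toSite r) ((Lc : ℤ) • y + toSite v))) := by
  obtain ⟨p, q, C, δ, hδ, hpq⟩ := loc_diagK_smul_sum_legInd Lc (toSite r) ξ y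
  exact ⟨_, δ, hδ, decays_of_biLoc hpq hδ.le⟩

/-! ## §1 Level 0: the kernel law of `WrecOf … 0` from the three level-0 letters -/

/-- [folklore] **THE LEVEL-0 WARD KERNEL LAW `hWd 0` OF THE SLOTTED W-TABLES FROM THE LEVEL-0 LETTERS.**  Slots and resolvent sockets as in the module
docstring (only the level-`0` sockets are used; (c1) is not needed at level `0`); generator `X y = diagK (ξ • Σ_v legInd (toSite r) (Lc•y+v))`, constant `cH 0`.
LETTERS (displayed hypotheses, bounded remainders): the WILSON letter of `cE₂ • wilsonW₂ d T` against `cE • wilsonA d` in both slots (`hWil`, `hWil''`), the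
BORDER letter of `cB • vh₂S` against `cVH • V` in both slots (`hBord`, `hBord''`), the MIXED letter of `M2Of mixFF 0` against `M 0` (`hM₂`).
CONCLUSION: part B's kernel law at `j = 0` with `R := RW + RB`, `R″ := RW″ + RB″`. -/
theorem divW_WrecOf_zero_of_letters
    (hLc : 1 ≤ Lc) (hV : ∀ δ : ℝ, 0 ≤ δ → ∃ C : ℝ, LocStencil V C δ) (hH : ∀ δ : ℝ, 0 ≤ δ → ∃ C : ℝ, VertexFamily H Lc C δ)
    (hG : ∀ j : ℕ, ∃ δ C : ℝ, 0 < δ ∧ 0 ≤ C ∧ Decays (G j) C δ) (hM : ∀ j : ℕ, ∃ CM δ : ℝ, 0 < δ ∧ VertexFamily (M j) Lc CM δ)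
    (cE cVH cΛ cE₂ cB : ℝ) (T : Fin 4 → Fin 4 → Fin 4 → Fin 4 → ℝ)
    {vh₂S : Fin (d + 1) → (Fin (d + 1) → ℤ) → Fin (d + 1) → (Fin (d + 1) → ℤ) → MKer (d + 1) (Fib d)}
    (hB : ∃ C δ : ℝ, 0 < δ ∧ LocStencil₂ vh₂S C δ)
    {mixFF : Fin (d + 1) → (Fin (d + 1) → ℤ) → Fin (d + 1) → (Fin (d + 1) → ℤ) → MKer (d + 1) (Fib d)}
    (hmix : ∃ C δ : ℝ, 0 < δ ∧ LocStencilFM Lc mixFF C δ)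
    -- the resolvent sockets, every level
    (𝕄 : ℕ → MKer (d + 1) (Fib d)) (h𝕄 : ∀ j, Spr (𝕄 j)) (E : MKer (d + 1) (Fib d)) (hE : Spr E) (hR : ∀ j, RelInv (G j) (𝕄 j) E)
    (cH : ℕ → ℝ)
    (hHc : ∀ (j : ℕ) (y : Fin (d + 1) → ℤ) (κ' : Fin (d + 1)) (u : Fin (d + 1) → ℤ),
      ∑ μ, (colH (G j) Lc μ (y - unitVec μ) κ' u - colH (G j) Lc μ y κ' u) = cH j * gaugeWt Lc y κ' u)
    (hMw : ∀ (j : ℕ) (y : Fin (d + 1) → ℤ) (ρ : Fin (d + 1)) (w : Fin (d + 1) → ℤ),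
      ∑ μ, (colM (G j) Lc μ (y - unitVec μ) ρ w - colM (G j) Lc μ y ρ w) = 0)
    (hoff : ∀ (j : ℕ) (x : Fin (d + 1) → ℤ), Literature.Probability.LatticeModels.Torus.proj Lc x ≠ 0 →
      ∀ (z : Fin (d + 1) → ℤ) (ρ μ : Fin (d + 1)), G j x z (Sum.inr ρ) (Sum.inr μ) = 0)
    {r : Fin (d + 1) → ℕ} (ξ : ℝ)
    (hEX : ∀ y : Fin (d + 1) → ℤ, comp E (diagK (ξ • ∑ v ∈ box (d + 1) Lc, legInd (toSite r) ((Lc : ℤ) • y + toSite v))) =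
      comp (diagK (ξ • ∑ v ∈ box (d + 1) Lc, legInd (toSite r) ((Lc : ℤ) • y + toSite v))) E)
    (hD : ∀ (j : ℕ) (y : Fin (d + 1) → ℤ), divV (dM (G j) Lc (SpureRecOf d Lc V H G cE cVH cΛ j) (M j)) y =
      conjV (𝕄 j) (diagK (ξ • ∑ v ∈ box (d + 1) Lc, legInd (toSite r) ((Lc : ℤ) • y + toSite v))))
    {RW RW'' RB RB'' : (Fin (d + 1) → ℤ) → Fin (d + 1) → (Fin (d + 1) → ℤ) → MKer (d + 1) (Fib d)} {BW BW'' BB BB'' : ℝ}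
    (hRWb : ∀ y κ u x z a b, |RW y κ u x z a b| ≤ BW) (hRW''b : ∀ y κ u x z a b, |RW'' y κ u x z a b| ≤ BW'')
    (hRBb : ∀ y κ u x z a b, |RB y κ u x z a b| ≤ BB) (hRB''b : ∀ y κ u x z a b, |RB'' y κ u x z a b| ≤ BB'')
    {RM : (Fin (d + 1) → ℤ) → Fin (d + 1) → (Fin (d + 1) → ℤ) → MKer (d + 1) (Fib d)} {BR' : ℝ}
    (hRMb : ∀ y ρ w x z a b, |RM y ρ w x z a b| ≤ BR')
    (hWil : ∀ (Y : Fin (d + 1) → ℤ) (κ' : Fin (d + 1)) (u' : Fin (d + 1) → ℤ),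
      cH 0 • ∑ v ∈ box (d + 1) Lc, divV (fun κ u => cE₂ • wilsonW₂ d T κ u κ' u') ((Lc : ℤ) • Y + toSite v) =
        comp (cE • wilsonA d κ' u') (diagK (ξ • ∑ v ∈ box (d + 1) Lc, legInd (toSite r) ((Lc : ℤ) • Y + toSite v))) - comp (diagK (ξ • ∑ v ∈ box (d + 1) Lc, legInd (toSite r) ((Lc : ℤ) • Y + toSite v))) (cE • wilsonA d κ' u') + RW Y κ' u')
    (hWil'' : ∀ (Y : Fin (d + 1) → ℤ) (κ : Fin (d + 1)) (u : Fin (d + 1) → ℤ),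
      cH 0 • ∑ v ∈ box (d + 1) Lc, divV (fun κ' u' => cE₂ • wilsonW₂ d T κ u κ' u') ((Lc : ℤ) • Y + toSite v) =
        comp (cE • wilsonA d κ u) (diagK (ξ • ∑ v ∈ box (d + 1) Lc, legInd (toSite r) ((Lc : ℤ) • Y + toSite v))) - comp (diagK (ξ • ∑ v ∈ box (d + 1) Lc, legInd (toSite r) ((Lc : ℤ) • Y + toSite v))) (cE • wilsonA d κ u) + RW'' Y κ u)
    (hBord : ∀ (Y : Fin (d + 1) → ℤ) (κ' : Fin (d + 1)) (u' : Fin (d + 1) → ℤ),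
      cH 0 • ∑ v ∈ box (d + 1) Lc, divV (fun κ u => cB • vh₂S κ u κ' u') ((Lc : ℤ) • Y + toSite v) =
        comp (cVH • V κ' u') (diagK (ξ • ∑ v ∈ box (d + 1) Lc, legInd (toSite r) ((Lc : ℤ) • Y + toSite v))) - comp (diagK (ξ • ∑ v ∈ box (d + 1) Lc, legInd (toSite r) ((Lc : ℤ) • Y + toSite v))) (cVH • V κ' u') + RB Y κ' u')
    (hBord'' : ∀ (Y : Fin (d + 1) → ℤ) (κ : Fin (d + 1)) (u : Fin (d + 1) → ℤ),
      cH 0 • ∑ v ∈ box (d + 1) Lc, divV (fun κ' u' => cB • vh₂S κ u κ' u') ((Lc : ℤ) • Y + toSite v) =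
        comp (cVH • V κ u) (diagK (ξ • ∑ v ∈ box (d + 1) Lc, legInd (toSite r) ((Lc : ℤ) • Y + toSite v))) - comp (diagK (ξ • ∑ v ∈ box (d + 1) Lc, legInd (toSite r) ((Lc : ℤ) • Y + toSite v))) (cVH • V κ u) + RB'' Y κ u)
    (hM₂ : ∀ (y : Fin (d + 1) → ℤ) (ρ' : Fin (d + 1)) (w : Fin (d + 1) → ℤ),
      cH 0 • ∑ v ∈ box (d + 1) Lc, divV (fun κ u => M2Of d Lc mixFF 0 κ u ρ' w) ((Lc : ℤ) • y + toSite v) =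
        comp (M 0 ρ' w) (diagK (ξ • ∑ v ∈ box (d + 1) Lc, legInd (toSite r) ((Lc : ℤ) • y + toSite v))) - comp (diagK (ξ • ∑ v ∈ box (d + 1) Lc, legInd (toSite r) ((Lc : ℤ) • y + toSite v))) (M 0 ρ' w) + RM y ρ' w)
    (y : Fin (d + 1) → ℤ) (ν : Fin (d + 1)) (y' : Fin (d + 1) → ℤ) :
    divW (WrecOf d Lc G (SpureRecOf d Lc V H G cE cVH cΛ) M cE₂ cB T vh₂S mixFF 0) y ν y' =
      conjV (dM (G 0) Lc (SpureRecOf d Lc V H G cE cVH cΛ 0) (M 0) ν y') (diagK (ξ • ∑ v ∈ box (d + 1) Lc, legInd (toSite r) ((Lc : ℤ) • y + toSite v)))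
        + (1 / 2 : ℝ) • (
          (dM (G 0) Lc (fun κ u => RW y κ u + RB y κ u) (RM y) ν y'
            - cH 0 • (∑ κ, wsum (fun u => ∑' x₂, ∑ κ₂,
                comp (G 0) (dM (G 0) Lc (SpureRecOf d Lc V H G cE cVH cΛ 0) (M 0) ν y') u x₂ (Sum.inl κ) (Sum.inl κ₂) * gaugeWt Lc y κ₂ x₂) (SpureRecOf d Lc V H G cE cVH cΛ 0 κ)
              + ∑ ρ', cwsum Lc (fun w => ∑' x₂, ∑ κ₂,
                comp (G 0) (dM (G 0) Lc (SpureRecOf d Lc V H G cE cVH cΛ 0) (M 0) ν y') ((Lc : ℤ) • w) x₂ (Sum.inr ρ') (Sum.inl κ₂) * gaugeWt Lc y κ₂ x₂) (M 0 ρ')))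
          + (dM (G 0) Lc (fun κ u => RW'' y κ u + RB'' y κ u) (RM y) ν y'
            + dM (conjV (G 0) (diagK (ξ • ∑ v ∈ box (d + 1) Lc, legInd (toSite r) ((Lc : ℤ) • y + toSite v)))) Lc (SpureRecOf d Lc V H G cE cVH cΛ 0) (M 0) ν y')) :=
  divW_WrecOf_of_tableLaws hLc hG (SpineRooted.locStencil_SpureRecOf (d := d) hLc hV hH hG cE cVH cΛ) hM cE₂ cB T hB hmix 0 (h𝕄 0) hE (hR 0)
    (cH 0) (hHc 0) (hMw 0) (hoff 0) (fun y => spr_blockGen (Lc := Lc) r ξ y) (fun y => loc_diagK_smul_sum_legInd Lc (toSite r) ξ y) hEX (hD 0)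
    (R := fun y κ u => RW y κ u + RB y κ u) (R'' := fun y κ u => RW'' y κ u + RB'' y κ u)
    (fun y κ u x z a b => abs_add_le' (hRWb y κ u) (hRBb y κ u) x z a b)
    (fun y κ u x z a b => abs_add_le' (hRW''b y κ u) (hRB''b y κ u) x z a b) hRMb
    (fun Y κ' u' => tableLaw_T2RecOf_zero (G := G) (M := M) cE cVH cΛ cE₂ cB T vh₂S mixFF hWil hBord Y κ' u')
    (fun Y κ u => tableLaw_T2RecOf_zero'' (G := G) (M := M) cE cVH cΛ cE₂ cB T vh₂S mixFF hWil'' hBord'' Y κ u) hM₂ y ν y'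

/-! ## §2 The induction step `hWd j ⟹ hWd (j+1)` -/

/-- [folklore] **THE INDUCTION STEP OF THE hW W-SIDE, SLOT-GENERIC: THE LEVEL-`j` KERNEL LAW OF `WrecOf … j` + THE TWO LEVEL-(j+1) LETTERS + THE LOCK
⟹ THE LEVEL-(j+1) KERNEL LAW OF `WrecOf … (j+1)`.**  HYPOTHESES (displayed): the slots' letters and the resolvent sockets of every level (module docstring;
used at levels `j` and `j+1`), the order-one consistency (c1) at level `j`; `hWd` — the level-`j` kernel law with a localised residual `𝒩` (`h𝒩`) whose
`G j`-sandwich block sums are uniformly bounded in both slots (`h𝒩b`, `h𝒩b''`); the BORDER letters at level `j+1` in both slots (`hBord`, `hBord''`, remainders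
`RB`, `RB″` bounded, constant `cH (j+1)`); the MIXED letter at level `j+1` (`hM₂`, remainder `RM` bounded); the lock `cH (j+1)·(cE₂·wV4 (j+1))·ξ = (cE·wE (j+1))·ξ`.
CONCLUSION: part B's kernel law at level `j+1` with `R := −(cH (j+1)·cE₂·wV4 (j+1)) • Σ_v mmRead Lc (G j∘𝒩 (Lc•Y+v) κ′ u′∘G j) + RB` and its second-slot twin. -/
theorem divW_WrecOf_succ_of_kernelLaw
    (hLc : 1 ≤ Lc) (hV : ∀ δ : ℝ, 0 ≤ δ → ∃ C : ℝ, LocStencil V C δ) (hH : ∀ δ : ℝ, 0 ≤ δ → ∃ C : ℝ, VertexFamily H Lc C δ)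
    (hG : ∀ j : ℕ, ∃ δ C : ℝ, 0 < δ ∧ 0 ≤ C ∧ Decays (G j) C δ) (hM : ∀ j : ℕ, ∃ CM δ : ℝ, 0 < δ ∧ VertexFamily (M j) Lc CM δ)
    (cE cVH cΛ cE₂ cB : ℝ) (T : Fin 4 → Fin 4 → Fin 4 → Fin 4 → ℝ)
    {vh₂S : Fin (d + 1) → (Fin (d + 1) → ℤ) → Fin (d + 1) → (Fin (d + 1) → ℤ) → MKer (d + 1) (Fib d)}
    (hB : ∃ C δ : ℝ, 0 < δ ∧ LocStencil₂ vh₂S C δ)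
    {mixFF : Fin (d + 1) → (Fin (d + 1) → ℤ) → Fin (d + 1) → (Fin (d + 1) → ℤ) → MKer (d + 1) (Fib d)}
    (hmix : ∃ C δ : ℝ, 0 < δ ∧ LocStencilFM Lc mixFF C δ)
    -- the resolvent sockets, every level
    (𝕄 : ℕ → MKer (d + 1) (Fib d)) (h𝕄 : ∀ j, Spr (𝕄 j)) (E : MKer (d + 1) (Fib d)) (hE : Spr E) (hR : ∀ j, RelInv (G j) (𝕄 j) E)
    (cH : ℕ → ℝ)
    (hHc : ∀ (j : ℕ) (y : Fin (d + 1) → ℤ) (κ' : Fin (d + 1)) (u : Fin (d + 1) → ℤ),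
      ∑ μ, (colH (G j) Lc μ (y - unitVec μ) κ' u - colH (G j) Lc μ y κ' u) = cH j * gaugeWt Lc y κ' u)
    (hMw : ∀ (j : ℕ) (y : Fin (d + 1) → ℤ) (ρ : Fin (d + 1)) (w : Fin (d + 1) → ℤ),
      ∑ μ, (colM (G j) Lc μ (y - unitVec μ) ρ w - colM (G j) Lc μ y ρ w) = 0)
    (hoff : ∀ (j : ℕ) (x : Fin (d + 1) → ℤ), Literature.Probability.LatticeModels.Torus.proj Lc x ≠ 0 →
      ∀ (z : Fin (d + 1) → ℤ) (ρ μ : Fin (d + 1)), G j x z (Sum.inr ρ) (Sum.inr μ) = 0)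
    {r : Fin (d + 1) → ℕ} (hr : r ∈ box (d + 1) Lc) (ξ : ℝ)
    (hEX : ∀ y : Fin (d + 1) → ℤ, comp E (diagK (ξ • ∑ v ∈ box (d + 1) Lc, legInd (toSite r) ((Lc : ℤ) • y + toSite v))) =
      comp (diagK (ξ • ∑ v ∈ box (d + 1) Lc, legInd (toSite r) ((Lc : ℤ) • y + toSite v))) E)
    (hD : ∀ (j : ℕ) (y : Fin (d + 1) → ℤ), divV (dM (G j) Lc (SpureRecOf d Lc V H G cE cVH cΛ j) (M j)) y =
      conjV (𝕄 j) (diagK (ξ • ∑ v ∈ box (d + 1) Lc, legInd (toSite r) ((Lc : ℤ) • y + toSite v))))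
    (hc1 : ∀ (j : ℕ) (κ : Fin (d + 1)) (u : Fin (d + 1) → ℤ),
      dM (G j) Lc (SpureRecOf d Lc V H G cE cVH cΛ j) (M j) κ u = vertexOfK (G j) Lc (SrecOf d Lc V H G cE cVH cΛ j) κ u)
    (j : ℕ)
    -- the level-`j` kernel law (induction hypothesis) with its localised residual and the uniform bound of its transported sandwich
    {𝒩 : (Fin (d + 1) → ℤ) → Fin (d + 1) → (Fin (d + 1) → ℤ) → MKer (d + 1) (Fib d)} (h𝒩 : ∀ y ν y', Loc (𝒩 y ν y'))
    (hWd : ∀ (y : Fin (d + 1) → ℤ) (ν : Fin (d + 1)) (y' : Fin (d + 1) → ℤ),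
      divW (WrecOf d Lc G (SpureRecOf d Lc V H G cE cVH cΛ) M cE₂ cB T vh₂S mixFF j) y ν y' =
        conjV (dM (G j) Lc (SpureRecOf d Lc V H G cE cVH cΛ j) (M j) ν y') (diagK (ξ • ∑ v ∈ box (d + 1) Lc, legInd (toSite r) ((Lc : ℤ) • y + toSite v))) + 𝒩 y ν y')
    {B𝒩 B𝒩'' : ℝ}
    (h𝒩b : ∀ (Y : Fin (d + 1) → ℤ) (κ' : Fin (d + 1)) (u' : Fin (d + 1) → ℤ) x z a b,
      |(∑ v ∈ box (d + 1) Lc, mmRead Lc (comp (comp (G j) (𝒩 ((Lc : ℤ) • Y + toSite v) κ' u')) (G j))) x z a b| ≤ B𝒩)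
    (h𝒩b'' : ∀ (Y : Fin (d + 1) → ℤ) (κ : Fin (d + 1)) (u : Fin (d + 1) → ℤ) x z a b,
      |(∑ v ∈ box (d + 1) Lc, mmRead Lc (comp (comp (G j) (𝒩 ((Lc : ℤ) • Y + toSite v) κ u)) (G j))) x z a b| ≤ B𝒩'')
    (hlock : cH (j + 1) * (cE₂ * wV4 d Lc (j + 1)) * ξ = (cE * wE d Lc (j + 1)) * ξ)
    -- the two level-(j+1) letters, bounded remainders
    {RB RB'' : (Fin (d + 1) → ℤ) → Fin (d + 1) → (Fin (d + 1) → ℤ) → MKer (d + 1) (Fib d)} {BB BB'' : ℝ}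
    (hRBb : ∀ y κ u x z a b, |RB y κ u x z a b| ≤ BB) (hRB''b : ∀ y κ u x z a b, |RB'' y κ u x z a b| ≤ BB'')
    (hBord : ∀ (Y : Fin (d + 1) → ℤ) (κ' : Fin (d + 1)) (u' : Fin (d + 1) → ℤ),
      cH (j + 1) • ∑ v ∈ box (d + 1) Lc, divV (fun κ u => (cB * wB2 d Lc (j + 1)) • vh₂S κ u κ' u') ((Lc : ℤ) • Y + toSite v) =
        comp ((cVH * wVH d Lc (j + 1)) • V κ' u') (diagK (ξ • ∑ v ∈ box (d + 1) Lc, legInd (toSite r) ((Lc : ℤ) • Y + toSite v)))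
          - comp (diagK (ξ • ∑ v ∈ box (d + 1) Lc, legInd (toSite r) ((Lc : ℤ) • Y + toSite v))) ((cVH * wVH d Lc (j + 1)) • V κ' u') + RB Y κ' u')
    (hBord'' : ∀ (Y : Fin (d + 1) → ℤ) (κ : Fin (d + 1)) (u : Fin (d + 1) → ℤ),
      cH (j + 1) • ∑ v ∈ box (d + 1) Lc, divV (fun κ' u' => (cB * wB2 d Lc (j + 1)) • vh₂S κ u κ' u') ((Lc : ℤ) • Y + toSite v) =
        comp ((cVH * wVH d Lc (j + 1)) • V κ u) (diagK (ξ • ∑ v ∈ box (d + 1) Lc, legInd (toSite r) ((Lc : ℤ) • Y + toSite v)))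
          - comp (diagK (ξ • ∑ v ∈ box (d + 1) Lc, legInd (toSite r) ((Lc : ℤ) • Y + toSite v))) ((cVH * wVH d Lc (j + 1)) • V κ u) + RB'' Y κ u)
    {RM : (Fin (d + 1) → ℤ) → Fin (d + 1) → (Fin (d + 1) → ℤ) → MKer (d + 1) (Fib d)} {BR' : ℝ}
    (hRMb : ∀ y ρ w x z a b, |RM y ρ w x z a b| ≤ BR')
    (hM₂ : ∀ (y : Fin (d + 1) → ℤ) (ρ' : Fin (d + 1)) (w : Fin (d + 1) → ℤ),
      cH (j + 1) • ∑ v ∈ box (d + 1) Lc, divV (fun κ u => M2Of d Lc mixFF (j + 1) κ u ρ' w) ((Lc : ℤ) • y + toSite v) =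
        comp (M (j + 1) ρ' w) (diagK (ξ • ∑ v ∈ box (d + 1) Lc, legInd (toSite r) ((Lc : ℤ) • y + toSite v))) - comp (diagK (ξ • ∑ v ∈ box (d + 1) Lc, legInd (toSite r) ((Lc : ℤ) • y + toSite v))) (M (j + 1) ρ' w) + RM y ρ' w)
    (y : Fin (d + 1) → ℤ) (ν : Fin (d + 1)) (y' : Fin (d + 1) → ℤ) :
    divW (WrecOf d Lc G (SpureRecOf d Lc V H G cE cVH cΛ) M cE₂ cB T vh₂S mixFF (j + 1)) y ν y' =
      conjV (dM (G (j + 1)) Lc (SpureRecOf d Lc V H G cE cVH cΛ (j + 1)) (M (j + 1)) ν y') (diagK (ξ • ∑ v ∈ box (d + 1) Lc, legInd (toSite r) ((Lc : ℤ) • y + toSite v)))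
        + (1 / 2 : ℝ) • (
          (dM (G (j + 1)) Lc (fun κ' u' => -(cH (j + 1) * (cE₂ * wV4 d Lc (j + 1))) •
                  ∑ v ∈ box (d + 1) Lc, mmRead Lc (comp (comp (G j) (𝒩 ((Lc : ℤ) • y + toSite v) κ' u')) (G j))
                + RB y κ' u') (RM y) ν y'
            - cH (j + 1) • (∑ κ, wsum (fun u => ∑' x₂, ∑ κ₂,
                comp (G (j + 1)) (dM (G (j + 1)) Lc (SpureRecOf d Lc V H G cE cVH cΛ (j + 1)) (M (j + 1)) ν y') u x₂ (Sum.inl κ) (Sum.inl κ₂) * gaugeWt Lc y κ₂ x₂) (SpureRecOf d Lc V H G cE cVH cΛ (j + 1) κ)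
              + ∑ ρ', cwsum Lc (fun w => ∑' x₂, ∑ κ₂,
                comp (G (j + 1)) (dM (G (j + 1)) Lc (SpureRecOf d Lc V H G cE cVH cΛ (j + 1)) (M (j + 1)) ν y') ((Lc : ℤ) • w) x₂ (Sum.inr ρ') (Sum.inl κ₂) * gaugeWt Lc y κ₂ x₂) (M (j + 1) ρ')))
          + (dM (G (j + 1)) Lc (fun κ u => -(cH (j + 1) * (cE₂ * wV4 d Lc (j + 1))) •
                  ∑ v ∈ box (d + 1) Lc, mmRead Lc (comp (comp (G j) (𝒩 ((Lc : ℤ) • y + toSite v) κ u)) (G j))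
                + RB'' y κ u) (RM y) ν y'
            + dM (conjV (G (j + 1)) (diagK (ξ • ∑ v ∈ box (d + 1) Lc, legInd (toSite r) ((Lc : ℤ) • y + toSite v)))) Lc (SpureRecOf d Lc V H G cE cVH cΛ (j + 1)) (M (j + 1)) ν y')) :=
  divW_WrecOf_of_tableLaws hLc hG (SpineRooted.locStencil_SpureRecOf (d := d) hLc hV hH hG cE cVH cΛ) hM cE₂ cB T hB hmix (j + 1) (h𝕄 (j + 1)) hE
    (hR (j + 1)) (cH (j + 1)) (hHc (j + 1)) (hMw (j + 1)) (hoff (j + 1)) (fun y => spr_blockGen (Lc := Lc) r ξ y)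
    (fun y => loc_diagK_smul_sum_legInd Lc (toSite r) ξ y) hEX (hD (j + 1))
    (R := fun Y κ' u' => -(cH (j + 1) * (cE₂ * wV4 d Lc (j + 1))) •
        ∑ v ∈ box (d + 1) Lc, mmRead Lc (comp (comp (G j) (𝒩 ((Lc : ℤ) • Y + toSite v) κ' u')) (G j)) + RB Y κ' u')
    (R'' := fun Y κ u => -(cH (j + 1) * (cE₂ * wV4 d Lc (j + 1))) •
        ∑ v ∈ box (d + 1) Lc, mmRead Lc (comp (comp (G j) (𝒩 ((Lc : ℤ) • Y + toSite v) κ u)) (G j)) + RB'' Y κ u)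
    (fun Y κ' u' x z a b => abs_smul_add_le _ (h𝒩b Y κ' u') (hRBb Y κ' u') x z a b)
    (fun Y κ u x z a b => abs_smul_add_le _ (h𝒩b'' Y κ u) (hRB''b Y κ u) x z a b) hRMb
    (fun Y κ' u' => tableLaw_T2RecOf_succ hLc hV hH hG hM cE cVH cΛ cE₂ cB T hB hmix j (h𝕄 j) hE (hR j) hr ξ hEX (hD j) (hc1 j) h𝒩 hWd hlock
      hBord Y κ' u')
    (fun Y κ u => tableLaw_T2RecOf_succ'' hLc hV hH hG hM cE cVH cΛ cE₂ cB T hB hmix j (h𝕄 j) hE (hR j) hr ξ hEX (hD j) (hc1 j) h𝒩 hWd hlock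
      hBord'' Y κ u)
    hM₂ y ν y'

end Slot

end Summit.QuantumFields.BalabanUV.Beta.WardLocusRecursiveAllSlot

end
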